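import Summits.AtomisticToContinuum.BoseEinsteinCondensation.Theorems.BECConjugateDominationPuffFloorInnerPairCountGlue
import Summits.AtomisticToContinuum.BoseEinsteinCondensation.Theorems.BECConjugateDominationPuffFloorWeakPairSubsolution
import Summits.AtomisticToContinuum.BoseEinsteinCondensation.Theorems.BECConjugateDominationPuffFloorSmearedPairDensityLaplacian
import Summits.AtomisticToContinuum.BoseEinsteinCondensation.Theorems.BECConjugateDominationPuffFloorMaxPrinciple

/-!
# Route `BECConjugateDomination`, crux `PuffFloor` (stmt-AtomisticToContinuum-11785),
# line `coupling-slope-pocket`, stub S7in `stub_innerPairCount` (discharge)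

Supports (does not close) stmt-AtomisticToContinuum-11785; proves the registered stub S7in of skeleton v6 by name and
signature: the glue `PuffFloorInnerPairCount.innerPairCount_of` applied to the landed stubs S7a
(`stub_weakPairSubsolution`), S7c (`stub_smearedPairDensityLaplacian`) and S7d (`stub_maxPrinciple`).
-/

noncomputable section

namespace Summit.AtomisticToContinuum.BoseEinsteinCondensation.Theorems

open MeasureTheory Filter
open scoped ENNReal NNReal BigOperators Laplacian
open Literature.MathematicalPhysics.QuantumManyBody.BoseGas

/-- **S7in `stub_innerPairCount` — no clustering inside the barrier of a coreless potential, for the exact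
minimiser.** For a smooth finite coreless `v` (`v 0 = 0`) not vanishing identically on `(0,∞)` there are
`r_in > 0`, `C_in ≥ 0`, `L₁ > 0`, `λ₁ > 0` such that on every torus of side `L ≥ L₁`, every real `C³` exact minimiser
of `n+2` bosons with removal energy `E₀(n+2,L) − E₀(n,L) ≤ λ₁` has
`E_Ψ #{i<j : |xᵢ−xⱼ|_T ≤ r_in} ≤ C_in · periodicEnergy v Ψ`. Proof: `PuffFloorInnerPairCount.innerPairCount_of`
(maximum principle for the smeared pair density, see that file) fed with the three landed analytic stubs.
Sources: Protter–Weinberger (1967) Ch. 2 Thm 10; LSSY2005 Ch. 2. -/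
theorem stub_innerPairCount :
    ∀ v : ℝ → ℝ≥0∞, IsRepulsiveFiniteRange v → (∀ r, v r ≠ ⊤) →
      ContDiff ℝ 2 (fun x : Space => (v ‖x‖).toReal) →
      v 0 = 0 → (∃ r, 0 < r ∧ 0 < v r) →
      ∃ rin Cin L₁ lam₁ : ℝ, 0 < rin ∧ 0 ≤ Cin ∧ 0 < L₁ ∧ 0 < lam₁ ∧
        ∀ (n : ℕ) (L : ℝ), L₁ ≤ L → ∀ Ψ : PeriodicTrialState (n + 2) L,
          periodicEnergy v Ψ = periodicGroundStateEnergy v (n + 2) L → periodicEnergy v Ψ ≠ ⊤ →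
          ContDiff ℝ 3 Ψ.ψ → (∀ X, Ψ.ψ X = (‖Ψ.ψ X‖ : ℂ)) →
          (periodicGroundStateEnergy v (n + 2) L).toReal - (periodicGroundStateEnergy v n L).toReal ≤ lam₁ →
          (∫⁻ X in cellN (n + 2) L,
              periodicInteraction (Set.indicator (Set.Iic rin) (fun _ : ℝ => (1 : ℝ≥0∞))) L X *
                (‖Ψ.ψ X‖₊ : ℝ≥0∞) ^ 2)
            ≤ ENNReal.ofReal Cin * periodicEnergy v Ψ :=
  PuffFloorInnerPairCount.innerPairCount_of stub_weakPairSubsolution stub_smearedPairDensityLaplacian stub_maxPrinciple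

end Summit.AtomisticToContinuum.BoseEinsteinCondensation.Theorems

end
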